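import Summits.Ventures.QEC.CircuitDistance.SchedNormal
import HarnessLib

/-!
# Q4 lane, ₛ-spine (4b): the BRIDGE for any CNOT order — residual syndrome zero (T2), the MERGE lemma, `card` for `faultCount`
# (venture QEC, experiment cell CDX; drafted by qec-cdx-idea-2 g2, typed by qec-cdx-type-2, statement audit qec-cdx-crit-1, director-qec R158; the remainder of `PortBridge.lean` of record — everything except
# `SameCols` / `logicalError_iff`, which are `Gen.SameCols` / `Gen.logicalError_iff` of `SchedNormal.lean` — re-pointed to an arbitrary
# event list `es` (order-FREE statements, once, at `Gen` level) resp. to `allEventsₛ σ Nc` under `hσ : σ.CycleFacts S` (telescoping only);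
# nothing here asserts a value of `d_circ`)

* telescoping (needs `hσ`): `run1ₛ_mZ_zero` / `run1ₛ_mX_zero`, `flipZₛ_zero` / `flipXₛ_zero`, **`residual_syndrome_zeroₛ`** — an undetectable
  fault set of the `Nc`-circuit of `σ` leaves a residual data error with `H^Z·dataX = 0 ∧ H^X·dataZ = 0` (+ the two projections
  `residual_HZ_dataX_zeroₛ` / `residual_HX_dataZ_zeroₛ`);
* merging, ORDER-FREE over any event list `es` (linearity of `simulate` in the Pauli at one operation, `simulate_init_add`):
  `Gen.run1_merge`, `Gen.detZ_merge` / `Gen.detX_merge`, `Gen.dataX_merge` / `Gen.dataZ_merge`, `Gen.merge_step`,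
  **`Gen.exists_reduced`** (every fault set is matched column for column by a REDUCED one on a subset of its operations with
  `card ≤ faultCount`), `Gen.hasAt_iff_reduced`, and the variant's reading `hasAtₛ_iff_reduced σ S Nc w` (no hypothesis on `σ`);
* anchors at print's order by `exact` (the landed `exists_reduced`, `hasAt_iff_reduced`, `residual_syndrome_zero` re-derived).
`Fault.merge`, `Fault.loc_merge`, `Fault.ev_eq_of_loc_eq`, `delta_merge`, `decide_add_eq_one`, `ZMod2_eq_zero_of_ne_one`, `Reduced`,
`faultCount_eq_card_of_reduced` are the tree's (order-free, reused unchanged). Proofs verbatim from `PortBridge.lean` modulo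
`run1/flipZ/detZ/dataX S Nc ↦ Gen.… S (Nc) es`, `shape ↦ shapeₛ σ S`, `mem_allEvents_iff ↦ hσ.mem_allEventsₛ_iff`, `run1_mZ ↦ run1ₛ_mZ hσ`.
These are the two `PortBridge` facts the sector theorems consume (`exists_reduced`, `residual_syndrome_zero` in `PortXSector` /
`PortZSector` / `PortSectorFinal` / `PortCoverFast`).
-/

namespace Summit.Ventures.QEC.CircuitDistance

open Literature.InformationTheory.QuantumCodes

variable {ℓ m : ℕ} [NeZero ℓ] [NeZero m]

/-! ## T2: telescoping, in the `Nc`-circuit of `σ` -/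

/-- No fault flips a `Z`-check outcome of "cycle 0" (there is none). -/
theorem run1ₛ_mZ_zero {σ : SMSchedule} {S : SMCode ℓ m} (hσ : σ.CycleFacts S) (Nc : ℕ) (f : Fault ℓ m) (j : BB.Mono ℓ m) :
    (Gen.run1 S (allEventsₛ σ Nc) f).mZ 0 j = false := by
  by_cases h : f.ev ∈ allEventsₛ σ Nc
  · rw [hσ.mem_allEventsₛ_iff, Fault.ev_cyc] at h
    rw [run1ₛ_mZ hσ Nc f h.1 h.2, if_neg (by omega)]
    exact shapeₛ_mZ_of_ne σ S f (by omega) j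
  · rw [show Gen.run1 S (allEventsₛ σ Nc) f = State.init from run1ₛ_of_not_mem σ S Nc f h]; rfl

/-- No fault flips an `X`-check outcome of "cycle 0". -/
theorem run1ₛ_mX_zero {σ : SMSchedule} {S : SMCode ℓ m} (hσ : σ.CycleFacts S) (Nc : ℕ) (f : Fault ℓ m) (i : BB.Mono ℓ m) :
    (Gen.run1 S (allEventsₛ σ Nc) f).mX 0 i = false := by
  by_cases h : f.ev ∈ allEventsₛ σ Nc
  · rw [hσ.mem_allEventsₛ_iff, Fault.ev_cyc] at h
    rw [run1ₛ_mX hσ Nc f h.1 h.2, if_neg (by omega)]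
    exact shapeₛ_mX_of_ne σ S f (by omega) i
  · rw [show Gen.run1 S (allEventsₛ σ Nc) f = State.init from run1ₛ_of_not_mem σ S Nc f h]; rfl

/-- The telescoping base: `Gen.flipZ … 0 = false` (cf. `flipZ_zero`). -/
theorem flipZₛ_zero {σ : SMSchedule} {S : SMCode ℓ m} (hσ : σ.CycleFacts S) (Nc : ℕ) (F : Finset (Fault ℓ m)) (j : BB.Mono ℓ m) :
    Gen.flipZ S (allEventsₛ σ Nc) F 0 j = false := by
  unfold Gen.flipZ; rw [bsum_congr (fun f _ => run1ₛ_mZ_zero hσ Nc f j)]; exact bsum_false F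

/-- The telescoping base: `Gen.flipX … 0 = false` (cf. `flipX_zero`). -/
theorem flipXₛ_zero {σ : SMSchedule} {S : SMCode ℓ m} (hσ : σ.CycleFacts S) (Nc : ℕ) (F : Finset (Fault ℓ m)) (i : BB.Mono ℓ m) :
    Gen.flipX S (allEventsₛ σ Nc) F 0 i = false := by
  unfold Gen.flipX; rw [bsum_congr (fun f _ => run1ₛ_mX_zero hσ Nc f i)]; exact bsum_false F

/-- **T2 (residual syndrome), any order.** An undetectable fault set of the `Nc`-circuit of `σ` leaves a residual data error with ZERO
true syndrome (cf. `residual_syndrome_zero`). -/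
theorem residual_syndrome_zeroₛ {σ : SMSchedule} {S : SMCode ℓ m} (hσ : σ.CycleFacts S) (Nc : ℕ) (F : Finset (Fault ℓ m))
    (hU : Undetectableₛ σ S Nc F) :
    S.toCode.HZ.mulVec (Gen.dataX S (allEventsₛ σ Nc) F) = 0 ∧ S.toCode.HX.mulVec (Gen.dataZ S (allEventsₛ σ Nc) F) = 0 := by
  unfold Undetectableₛ Gen.Undetectable at hU
  obtain ⟨-, hdet⟩ := hU
  -- telescoping: all outcome flips vanish
  have hZ : ∀ t, t ≤ Nc → ∀ j, Gen.flipZ S (allEventsₛ σ Nc) F t j = false := by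
    intro t
    induction t with
    | zero => intro _ j; exact flipZₛ_zero hσ Nc F j
    | succ t ih =>
      intro ht j
      have h := (hdet (t + 1) j).2
      unfold Gen.detZ at h
      rw [if_neg (by omega), if_pos ht, Nat.add_sub_cancel, ih (by omega) j, Bool.xor_false] at h
      exact h
  have hX : ∀ t, t ≤ Nc → ∀ i, Gen.flipX S (allEventsₛ σ Nc) F t i = false := by
    intro t
    induction t with
    | zero => intro _ i; exact flipXₛ_zero hσ Nc F i
    | succ t ih =>
      intro ht i
      have h := (hdet (t + 1) i).1
      unfold Gen.detX at h
      rw [if_neg (by omega), if_pos ht, Nat.add_sub_cancel, ih (by omega) i, Bool.xor_false] at h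
      exact h
  constructor
  · funext j
    have h := (hdet (Nc + 1) j).2
    unfold Gen.detZ at h
    rw [if_neg (by omega), if_neg (by omega), if_pos rfl, hZ Nc le_rfl j, Bool.xor_false, decide_eq_false_iff_not] at h
    exact ZMod2_eq_zero_of_ne_one h
  · funext i
    have h := (hdet (Nc + 1) i).1
    unfold Gen.detX at h
    rw [if_neg (by omega), if_neg (by omega), if_pos rfl, hX Nc le_rfl i, Bool.xor_false, decide_eq_false_iff_not] at h
    exact ZMod2_eq_zero_of_ne_one h


/-! ## Merging faults on one operation, for an arbitrary event list (`Fault.merge`, `delta_merge`, `Reduced` are the tree's) -/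

/-- **Linearity in the Pauli at one operation**, any event list: the effect of the merged fault is the sum of the effects
(cf. `run1_merge`). -/
theorem Gen.run1_merge (S : SMCode ℓ m) (es : List Ev) {f g : Fault ℓ m} (h : f.loc = g.loc) (hne : f ≠ g) :
    Gen.run1 S es (f.merge g) = (Gen.run1 S es f).add (Gen.run1 S es g) := by
  unfold Gen.run1
  have hev : (f.merge g).ev = f.ev := Fault.ev_eq_of_loc_eq (Fault.loc_merge h)
  have hev' : g.ev = f.ev := (Fault.ev_eq_of_loc_eq h).symm
  exact simulate_init_add S hev.symm (hev'.trans hev.symm) (delta_merge S h hne) es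

/-- Columns of the merged fault: `Z`-detectors add (cf. `detZ_merge`). -/
theorem Gen.detZ_merge (S : SMCode ℓ m) (Nc : ℕ) (es : List Ev) {f g : Fault ℓ m} (h : f.loc = g.loc) (hne : f ≠ g) (t : ℕ) (j : BB.Mono ℓ m) :
    Gen.detZ S Nc es {f.merge g} t j = xor (Gen.detZ S Nc es {f} t j) (Gen.detZ S Nc es {g} t j) := by
  have hd : Gen.dataX S es {f.merge g} = Gen.dataX S es {f} + Gen.dataX S es {g} := by
    rw [Gen.dataX_singleton_run1, Gen.dataX_singleton_run1, Gen.dataX_singleton_run1, Gen.run1_merge S es h hne, ← toZ2_xor]; rfl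
  unfold Gen.detZ
  simp only [Gen.flipZ_singleton, Gen.run1_merge S es h hne, hd, Matrix.mulVec_add, Pi.add_apply, decide_add_eq_one]
  split_ifs
  · rfl
  · show xor (xor _ _) (xor _ _) = _
    generalize (Gen.run1 S es f).mZ t j = a; generalize (Gen.run1 S es g).mZ t j = b
    generalize (Gen.run1 S es f).mZ (t - 1) j = c; generalize (Gen.run1 S es g).mZ (t - 1) j = d
    cases a <;> cases b <;> cases c <;> cases d <;> rfl
  · show xor (xor _ _) (xor _ _) = _
    generalize decide ((S.toCode.HZ.mulVec (Gen.dataX S es {f})) j = 1) = a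
    generalize decide ((S.toCode.HZ.mulVec (Gen.dataX S es {g})) j = 1) = b
    generalize (Gen.run1 S es f).mZ Nc j = c; generalize (Gen.run1 S es g).mZ Nc j = d
    cases a <;> cases b <;> cases c <;> cases d <;> rfl
  · rfl

/-- Columns of the merged fault: `X`-detectors add (cf. `detX_merge`). -/
theorem Gen.detX_merge (S : SMCode ℓ m) (Nc : ℕ) (es : List Ev) {f g : Fault ℓ m} (h : f.loc = g.loc) (hne : f ≠ g) (t : ℕ) (i : BB.Mono ℓ m) :
    Gen.detX S Nc es {f.merge g} t i = xor (Gen.detX S Nc es {f} t i) (Gen.detX S Nc es {g} t i) := by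
  have hd : Gen.dataZ S es {f.merge g} = Gen.dataZ S es {f} + Gen.dataZ S es {g} := by
    rw [Gen.dataZ_singleton_run1, Gen.dataZ_singleton_run1, Gen.dataZ_singleton_run1, Gen.run1_merge S es h hne, ← toZ2_xor]; rfl
  unfold Gen.detX
  simp only [Gen.flipX_singleton, Gen.run1_merge S es h hne, hd, Matrix.mulVec_add, Pi.add_apply, decide_add_eq_one]
  split_ifs
  · rfl
  · show xor (xor _ _) (xor _ _) = _
    generalize (Gen.run1 S es f).mX t i = a; generalize (Gen.run1 S es g).mX t i = b
    generalize (Gen.run1 S es f).mX (t - 1) i = c; generalize (Gen.run1 S es g).mX (t - 1) i = d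
    cases a <;> cases b <;> cases c <;> cases d <;> rfl
  · show xor (xor _ _) (xor _ _) = _
    generalize decide ((S.toCode.HX.mulVec (Gen.dataZ S es {f})) i = 1) = a
    generalize decide ((S.toCode.HX.mulVec (Gen.dataZ S es {g})) i = 1) = b
    generalize (Gen.run1 S es f).mX Nc i = c; generalize (Gen.run1 S es g).mX Nc i = d
    cases a <;> cases b <;> cases c <;> cases d <;> rfl
  · rfl

/-- Residual `X`-errors of the merged fault add (cf. `dataX_merge`). -/
theorem Gen.dataX_merge (S : SMCode ℓ m) (es : List Ev) {f g : Fault ℓ m} (h : f.loc = g.loc) (hne : f ≠ g) :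
    Gen.dataX S es {f.merge g} = Gen.dataX S es {f} + Gen.dataX S es {g} := by
  rw [Gen.dataX_singleton_run1, Gen.dataX_singleton_run1, Gen.dataX_singleton_run1, Gen.run1_merge S es h hne, ← toZ2_xor]; rfl

/-- Residual `Z`-errors of the merged fault add (cf. `dataZ_merge`). -/
theorem Gen.dataZ_merge (S : SMCode ℓ m) (es : List Ev) {f g : Fault ℓ m} (h : f.loc = g.loc) (hne : f ≠ g) :
    Gen.dataZ S es {f.merge g} = Gen.dataZ S es {f} + Gen.dataZ S es {g} := by
  rw [Gen.dataZ_singleton_run1, Gen.dataZ_singleton_run1, Gen.dataZ_singleton_run1, Gen.run1_merge S es h hne, ← toZ2_xor]; rfl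

/-! ## Reduction to one fault per operation, for an arbitrary event list -/

/-- One MERGE STEP, any event list: replace two distinct faults `f ≠ g` on one operation by their product (toggled)
(cf. `merge_step`). -/
theorem Gen.merge_step (S : SMCode ℓ m) (Nc : ℕ) (es : List Ev) (F : Finset (Fault ℓ m)) {f g : Fault ℓ m} (hf : f ∈ F) (hg : g ∈ F)
    (hne : f ≠ g) (h : f.loc = g.loc) :
    ∃ F' : Finset (Fault ℓ m), F'.card < F.card ∧ F'.image Fault.loc ⊆ F.image Fault.loc ∧ Gen.SameCols S Nc es F F' := by
  classical
  set R := (F.erase f).erase g with hR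
  have hgR : g ∈ F.erase f := Finset.mem_erase.2 ⟨hne.symm, hg⟩
  have hRcard : R.card + 2 = F.card := by
    rw [hR, Finset.card_erase_of_mem hgR, Finset.card_erase_of_mem hf]
    have := Finset.card_pos.2 ⟨f, hf⟩
    have : 2 ≤ F.card := by
      have : ({f, g} : Finset (Fault ℓ m)) ⊆ F := by
        intro x hx; rcases Finset.mem_insert.1 hx with rfl | hx
        · exact hf
        · rw [Finset.mem_singleton.1 hx]; exact hg
      have h2 := Finset.card_le_card this
      rw [Finset.card_pair hne] at h2; exact h2
    omega
  have hFR : F = insert f (insert g R) := by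
    rw [hR, Finset.insert_erase hgR, Finset.insert_erase hf]
  have hfR : f ∉ insert g R := by
    rw [Finset.mem_insert, not_or]; exact ⟨hne, fun h' => by rw [hR] at h'; exact (Finset.mem_erase.1 (Finset.mem_erase.1 h').2).1 rfl⟩
  have hgR' : g ∉ R := fun h' => (Finset.mem_erase.1 h').1 rfl
  -- parity bookkeeping for Bool- and 𝔽₂-valued columns
  have key_b : ∀ (col : Fault ℓ m → Bool), col (f.merge g) = xor (col f) (col g) →
      ∀ F' : Finset (Fault ℓ m), (F' = if f.merge g ∈ R then R.erase (f.merge g) else insert (f.merge g) R) →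
      bsum F' col = bsum F col := by
    intro col hcol F' hF'
    rw [hFR, bsum_insert hfR, bsum_insert hgR']
    split_ifs at hF' with hm
    · rw [hF']
      have := bsum_insert (Finset.notMem_erase (f.merge g) R) col
      rw [Finset.insert_erase hm, hcol] at this
      rw [this]; cases col f <;> cases col g <;> cases bsum (R.erase (f.merge g)) col <;> rfl
    · rw [hF', bsum_insert hm, hcol, Bool.xor_assoc]
  have key_v : ∀ (col : Fault ℓ m → (BB.Mono ℓ m ⊕ BB.Mono ℓ m → ZMod 2)), col (f.merge g) = col f + col g →
      ∀ F' : Finset (Fault ℓ m), (F' = if f.merge g ∈ R then R.erase (f.merge g) else insert (f.merge g) R) →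
      ∑ x ∈ F', col x = ∑ x ∈ F, col x := by
    intro col hcol F' hF'
    rw [hFR, Finset.sum_insert hfR, Finset.sum_insert hgR']
    split_ifs at hF' with hm
    · rw [hF']
      have := Finset.sum_insert (Finset.notMem_erase (f.merge g) R) (f := col)
      rw [Finset.insert_erase hm, hcol] at this
      rw [this]
      have h2 : col f + col g + (col f + col g + ∑ x ∈ R.erase (f.merge g), col x) = ∑ x ∈ R.erase (f.merge g), col x := by
        funext q; simp only [Pi.add_apply]
        have : ∀ a b c : ZMod 2, a + b + (a + b + c) = c := by decide
        exact this _ _ _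
      rw [← add_assoc, h2]
    · rw [hF', Finset.sum_insert hm, hcol, add_assoc]
  refine ⟨if f.merge g ∈ R then R.erase (f.merge g) else insert (f.merge g) R, ?_, ?_, ?_⟩
  · split_ifs with hm
    · have := Finset.card_erase_of_mem hm; omega
    · rw [Finset.card_insert_of_notMem hm]; omega
  · intro x hx
    rw [Finset.mem_image] at hx ⊢
    obtain ⟨y, hy, rfl⟩ := hx
    have hyR : y ∈ R ∨ y = f.merge g := by
      split_ifs at hy with hm
      · exact Or.inl (Finset.mem_of_mem_erase hy)
      · rcases Finset.mem_insert.1 hy with rfl | hy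
        · exact Or.inr rfl
        · exact Or.inl hy
    rcases hyR with hyR | rfl
    · exact ⟨y, Finset.mem_of_mem_erase (Finset.mem_of_mem_erase hyR), rfl⟩
    · exact ⟨f, hf, (Fault.loc_merge h).symm⟩
  · refine ⟨fun t i => ?_, fun t j => ?_, ?_, ?_⟩
    · rw [Gen.detX_eq_bsum, Gen.detX_eq_bsum S Nc es F]
      exact key_b (fun x => Gen.detX S Nc es {x} t i) (Gen.detX_merge S Nc es h hne t i) _ rfl
    · rw [Gen.detZ_eq_bsum, Gen.detZ_eq_bsum S Nc es F]
      exact key_b (fun x => Gen.detZ S Nc es {x} t j) (Gen.detZ_merge S Nc es h hne t j) _ rfl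
    · rw [Gen.dataX_eq_sum, Gen.dataX_eq_sum S es F]
      exact key_v (fun x => Gen.dataX S es {x}) (Gen.dataX_merge S es h hne) _ rfl
    · rw [Gen.dataZ_eq_sum, Gen.dataZ_eq_sum S es F]
      exact key_v (fun x => Gen.dataZ S es {x}) (Gen.dataZ_merge S es h hne) _ rfl

/-- **MERGE LEMMA, any event list.** Every fault set is matched, column for column, by a REDUCED set on a subset of its
operations with `card ≤ faultCount` (cf. `exists_reduced`). -/
theorem Gen.exists_reduced (S : SMCode ℓ m) (Nc : ℕ) (es : List Ev) (F : Finset (Fault ℓ m)) :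
    ∃ F' : Finset (Fault ℓ m), Reduced F' ∧ F'.card ≤ faultCount F ∧ F'.image Fault.loc ⊆ F.image Fault.loc ∧
      Gen.SameCols S Nc es F F' := by
  classical
  induction hn : F.card using Nat.strong_induction_on generalizing F with
  | _ n ih =>
    by_cases hR : Reduced F
    · exact ⟨F, hR, (faultCount_eq_card_of_reduced hR).ge, subset_rfl, Gen.SameCols.refl S Nc es F⟩
    · -- two distinct faults on one operation
      unfold Reduced Set.InjOn at hR
      push Not at hR
      obtain ⟨f, hf, g, hg, hloc, hne⟩ := hR
      obtain ⟨F₁, hcard, himg, hcols⟩ := Gen.merge_step S Nc es F (Finset.mem_coe.1 hf) (Finset.mem_coe.1 hg) hne hloc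
      obtain ⟨F', hR', hcard', himg', hcols'⟩ := ih F₁.card (by omega) F₁ rfl
      refine ⟨F', hR', ?_, himg'.trans himg, hcols.trans hcols'⟩
      calc F'.card ≤ faultCount F₁ := hcard'
        _ ≤ faultCount F := Finset.card_le_card himg

/-- Hence the weight predicate may be read with cardinality in place of `faultCount`, any event list (cf. `hasAt_iff_reduced`). -/
theorem Gen.hasAt_iff_reduced (S : SMCode ℓ m) (Nc : ℕ) (es : List Ev) (w : ℕ) :
    Gen.HasLogicalFaultOfWeightAtMostAt S Nc es w ↔
      ∃ F : Finset (Fault ℓ m), Reduced F ∧ Gen.Undetectable S Nc es F ∧ Gen.LogicalError S es F ∧ F.card ≤ w := by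
  constructor
  · rintro ⟨F, hU, hL, hw⟩
    obtain ⟨F', hR, hcard, himg, hX, hZ, hdX, hdZ⟩ := Gen.exists_reduced S Nc es F
    refine ⟨F', hR, ⟨?_, fun t i => ⟨?_, ?_⟩⟩, ?_, hcard.trans hw⟩
    · intro f' hf'
      have : f'.loc ∈ F.image Fault.loc := himg (Finset.mem_image_of_mem _ hf')
      obtain ⟨f, hf, hfl⟩ := Finset.mem_image.1 this
      rw [← Fault.ev_eq_of_loc_eq hfl]; exact hU.1 f hf
    · rw [hX]; exact (hU.2 t i).1
    · rw [hZ]; exact (hU.2 t i).2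
    · unfold Gen.LogicalError at hL ⊢; rw [hdX, hdZ]; exact hL
  · rintro ⟨F, hR, hU, hL, hw⟩
    exact ⟨F, hU, hL, (faultCount_eq_card_of_reduced hR).le.trans hw⟩


/-- The weight predicate of the variant `σ` read with cardinality in place of `faultCount` (cf. `hasAt_iff_reduced`; no hypothesis on `σ`). -/
theorem hasAtₛ_iff_reduced (σ : SMSchedule) (S : SMCode ℓ m) (Nc w : ℕ) :
    HasLogicalFaultOfWeightAtMostAtₛ σ S Nc w ↔
      ∃ F : Finset (Fault ℓ m), Reduced F ∧ Undetectableₛ σ S Nc F ∧ LogicalErrorₛ σ S Nc F ∧ F.card ≤ w :=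
  Gen.hasAt_iff_reduced S Nc (allEventsₛ σ Nc) w

/-- `XNontrivial`-style reading of T2 for a REDUCED undetectable set of the variant: the residual `X`-part has zero `Z`-syndrome
(cf. the use of `residual_syndrome_zero` in `PortXSector.no_xLogical_of_leaves`). -/
theorem residual_HZ_dataX_zeroₛ {σ : SMSchedule} {S : SMCode ℓ m} (hσ : σ.CycleFacts S) (Nc : ℕ) (F : Finset (Fault ℓ m))
    (hU : Undetectableₛ σ S Nc F) : S.toCode.HZ.mulVec (Gen.dataX S (allEventsₛ σ Nc) F) = 0 :=
  (residual_syndrome_zeroₛ hσ Nc F hU).1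

/-- … and the residual `Z`-part has zero `X`-syndrome. -/
theorem residual_HX_dataZ_zeroₛ {σ : SMSchedule} {S : SMCode ℓ m} (hσ : σ.CycleFacts S) (Nc : ℕ) (F : Finset (Fault ℓ m))
    (hU : Undetectableₛ σ S Nc F) : S.toCode.HX.mulVec (Gen.dataZ S (allEventsₛ σ Nc) F) = 0 :=
  (residual_syndrome_zeroₛ hσ Nc F hU).2

/-! ## Anchors at print's order: the landed statements re-derived (`allEvents Nc` by `exact`; `sched204` via `allEventsₛ_sched204`) -/

/-- Anchor: `Gen.exists_reduced` at `allEvents Nc` is the landed `exists_reduced` (statement by `exact`, all `Gen` anchors `rfl`). -/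
example (S : SMCode ℓ m) (Nc : ℕ) (F : Finset (Fault ℓ m)) :
    ∃ F' : Finset (Fault ℓ m), Reduced F' ∧ F'.card ≤ faultCount F ∧ F'.image Fault.loc ⊆ F.image Fault.loc ∧ SameCols S Nc F F' :=
  Gen.exists_reduced S Nc (allEvents Nc) F

/-- Anchor: `Gen.hasAt_iff_reduced` at `allEvents Nc` is the landed `hasAt_iff_reduced`. -/
example (S : SMCode ℓ m) (Nc w : ℕ) :
    HasLogicalFaultOfWeightAtMostAt S Nc w ↔
      ∃ F : Finset (Fault ℓ m), Reduced F ∧ Undetectable S Nc F ∧ LogicalError S Nc F ∧ F.card ≤ w :=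
  Gen.hasAt_iff_reduced S Nc (allEvents Nc) w

/-- Anchor: at print's order `sched204` the variant reading is the landed one (through `allEventsₛ_sched204`). -/
theorem hasAtₛ_iff_reduced_sched204 (S : SMCode ℓ m) (Nc w : ℕ) :
    HasLogicalFaultOfWeightAtMostAt S Nc w ↔
      ∃ F : Finset (Fault ℓ m), Reduced F ∧ Undetectableₛ sched204 S Nc F ∧ LogicalErrorₛ sched204 S Nc F ∧ F.card ≤ w := by
  rw [← hasLogicalFaultOfWeightAtMostAtₛ_sched204]; exact hasAtₛ_iff_reduced sched204 S Nc w

/-- Anchor: `residual_syndrome_zeroₛ (sched204_cycleFacts S)` gives back the landed `residual_syndrome_zero` (stated as an `example`: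
the statement IS the landed one, so it is not re-declared under a new name). -/
example (S : SMCode ℓ m) (Nc : ℕ) (F : Finset (Fault ℓ m)) (hU : Undetectable S Nc F) :
    S.toCode.HZ.mulVec (dataX S Nc F) = 0 ∧ S.toCode.HX.mulVec (dataZ S Nc F) = 0 := by
  have h := residual_syndrome_zeroₛ (sched204_cycleFacts S) Nc F ((undetectableₛ_sched204 S Nc F).2 hU)
  rw [allEventsₛ_sched204] at h
  exact h

end Summit.Ventures.QEC.CircuitDistance
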